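import Literature.AlgebraicGeometry.AbelianVarieties.MarkmanKernelSpan
import Literature.AlgebraicGeometry.AbelianVarieties.MarkmanPhiExchange
import Literature.AlgebraicGeometry.AbelianVarieties.HomogeneousLineBundleDivisor
import Literature.AlgebraicGeometry.Motives.AbelianVarietyCubeProofs
import HarnessLib

/-!
# The span kernel under translations of `A × A`: `(t_u × 1_Â)^* 𝒩 ≅ 𝒩 ⊗ g′^* M_u` with
# `M_u = pr_A^* P_{φ_Θ(u₁)} ⊗ (pr_Â^* P̂_{u₂})^∨` — Markman's Lemma 9.3.3 conjugation in class currency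

Layer `Literature/AlgebraicGeometry/AbelianVarieties`; sequel to `MarkmanKernelSpan` (`Φ ≅ Φ^{pr₁₂, g′}_{𝒩₁}`, the kernel
shear `Ξ`, `g′ = Ξ ≫ pr₁₃`, `𝒩₁ = Ξ^*pr₂₃^*𝒫^∨`). Here, for a complex point `u = (u₁, u₂)` of `A × A` acting on
`Z = (A × A) × Â` by `t_u × 1_Â`:

* §1 the AUTOMORPHISM SQUARES `(t_u × 1) ≫ pr₁₂ = pr₁₂ ≫ t_u` and **`(t_u × 1) ≫ g′ = g′ ≫ t_{p(u)}`** with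
  `p(u) = (u₁ u₂⁻¹, φ_Θ(u₁ u₂)) ∈ (A × Â)(ℂ)` (`pairTranslationIso`, `spanPoint`, `pairTranslation_comp_kernelSpanMap`) —
  print's «`μ⁻¹ ∘ (τ_{x₁}, τ_{x₂}) ∘ μ = (τ_{x₁ − x₂}, τ_{x₂})`», «`(τ_{x₁ − x₂}, τ_{L_{x₁ + x₂}})`» [Markman §9.3 p. 71 L54–70];
* §2 CLASS CALCULUS on `Z`-valued points (`CechPic`, written additively through `cechCl` and Mumford's biadditive pairing
  `Λ` of `Motives/AbelianVarietyCubeBilinear`): the classes of `P_α`, `P̂_x` along arbitrary `Z`-valued points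
  (`ofMul_pullback_detClass_linePt`, `…_linePtHat`), `Λ(c, d) = 0` for constant points, `Λ(c, x⁻¹) = −Λ(c, x)`, and the
  class of the span kernel **`[𝒩₁] = −Λ(b, β·φ_Θ⁻¹ · a · b)`** (`ofMul_detClass_markmanSpanKernel`);
* §3 the TWISTED span kernel `𝒩 := 𝒩₁ ⊗ a^*𝒪(Θ) ⊗ b^*𝒪(Θ)` (`markmanTwistedKernel`, rank one; print's source twist
  `[Θ ⊠ Θ] ⊗` of §9.2 absorbed into the kernel) and the Pic⁰ bundle `M_u := pr_A^*P_{φ_Θ(u₁)} ⊗ (pr_Â^*P̂_{u₂})^∨` on `A × Â`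
  (`translateTwist`; print's `L_g = π₁^*L_{x₁} ⊗ π₂^*𝒫_{−x₂}`), with their classes along `T`-valued points;
* §4 THE IDENTITY **`(t_u × 1)^*[𝒩] = [𝒩] · g′^*[M_u]`** (`pullback_pairTranslation_detClass_markmanTwistedKernel`) and its module
  form **`Nonempty ((t_u × 1)^*𝒩 ≅ 𝒩 ⊗ g′^*M_u)`** (`nonempty_pullback_pairTranslation_markmanTwistedKernel_iso`).

With §1 and `MarkmanKernelSpan` this is the input of the translate row `Φ̃(t_u^*M) ≅ t_{p(u)}^*(Φ̃(M)) ⊗ M_u⁻¹` for Markman's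
twisted `Φ̃ = Φ ∘ ([Θ⊠Θ] ⊗)` and GENERAL `u` (one base change along the automorphism square + the projection formula),
and of the kernel-descent road (the same identity says `σ(T) ≤ K(𝒩 ⊗ g′^*D′)` once `φ_{D′}(p(u)) = M_u⁻¹`).
Everything PROVED; 0 named facts; no instance, no notation. Typed for the cell `pub-hodge-ring2` (crux 26512, plates
(K1′)/(I)); a research route conditional on HC_CM, not a corollary — nothing in this file refers to it.

## References

* E. Markman, arXiv:2502.03415 (2025), §9.3 Lemma 9.3.3, p. 71 L44–70. [Markman2025SecantWeil]
* H. Lange, *Abelian Varieties over the Complex Numbers* (2023), §1.4.2, Lemma 6.1.3. [Lange2023AbelianVarietiesComplex]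
* D. Mumford, *Abelian Varieties* (1970), §6 Cor. 4, §8 (`Λ(L)`, `Pic⁰`). [MumfordAV1970]
* U. Görtz, T. Wedhorn, *Algebraic Geometry II* (2023), Def./Rem. 27.1 (p. 799), Prop. 27.167. [GortzWedhorn2023]
-/

noncomputable section

-- `TopCat.Presheaf`/`Scheme.Modules` are not reducible (as in Mathlib's `AlgebraicGeometry/Modules/Sheaf.lean`).
set_option backward.isDefEq.respectTransparency false

open CategoryTheory CategoryTheory.Limits AlgebraicGeometry MonoidalCategory CartesianMonoidalCategory
open AlgebraicGeometry.Scheme.Modules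

universe u

namespace Literature.AlgebraicGeometry.AbelianVarieties

open Literature.AlgebraicGeometry.Motives Literature.AlgebraicGeometry.Modules
open scoped MonObj

variable (A : AbelianVariety ℂ) {Θ : CartierDivisor A.X.left} (hΘ : Θ.IsAmple)

/-! ### §1 Translating `A × A`: the automorphism squares of the span `(pr₁₂, g′)` -/

section Squares

variable (u₁ u₂ : A.Points ℂ)

/-- The complex point `(u₁, u₂)` of `A × A`. [cite: GortzWedhorn2023, Def./Rem. 27.1 (p. 799)] -/
def pairPoint : (A.prod A).Points ℂ := lift u₁ u₂

/-- `(u₁, u₂) ≫ p₁ = u₁`. [cite: GortzWedhorn2023, Def./Rem. 27.1 (p. 799)] -/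
@[simp] theorem pairPoint_comp_fst : pairPoint A u₁ u₂ ≫ fst A.X A.X = u₁ := lift_fst _ _

/-- `(u₁, u₂) ≫ p₂ = u₂`. [cite: GortzWedhorn2023, Def./Rem. 27.1 (p. 799)] -/
@[simp] theorem pairPoint_comp_snd : pairPoint A u₁ u₂ ≫ snd A.X A.X = u₂ := lift_snd _ _

/-- **`t_{(u₁,u₂)} × 1_Â` as an isomorphism of the underlying scheme of `(A × A) × Â`.** [cite: GortzWedhorn2023, Def./Rem. 27.1 (p. 799)] -/
def pairTranslationIso : ((A.X ⊗ A.X) ⊗ (A.dualOf Θ hΘ).X).left ≅ ((A.X ⊗ A.X) ⊗ (A.dualOf Θ hΘ).X).left :=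
  (Over.forget _).mapIso (whiskerRightIso ((A.prod A).translationIso (pairPoint A u₁ u₂)) (A.dualOf Θ hΘ).X)

/-- Unfolding: `(pairTranslationIso u₁ u₂).hom = (t_{(u₁,u₂)} ▷ Â.X).left`. [cite: GortzWedhorn2023, Def./Rem. 27.1 (p. 799)] -/
theorem pairTranslationIso_hom :
    (pairTranslationIso A hΘ u₁ u₂).hom = (prodTranslation A A (pairPoint A u₁ u₂) ▷ (A.dualOf Θ hΘ).X).left := rfl

/-- `(t_u × 1)^*` is exact. [cite: Hartshorne1977, II §5 p. 110] -/
theorem preservesFiniteLimits_pullback_pairTranslation :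
    PreservesFiniteLimits (Scheme.Modules.pullback (pairTranslationIso A hΘ u₁ u₂).hom) :=
  preservesFiniteLimits_pullback_of_iso _

/-- **`(t_u × 1) ≫ pr₁₂ = pr₁₂ ≫ t_u`.** [cite: GortzWedhorn2023, Def./Rem. 27.1 (p. 799)] -/
theorem pairTranslation_comp_pr₁₂ :
    (prodTranslation A A (pairPoint A u₁ u₂) ▷ (A.dualOf Θ hΘ).X) ≫ pr₁₂ A A (A.dualOf Θ hΘ) =
      pr₁₂ A A (A.dualOf Θ hΘ) ≫ prodTranslation A A (pairPoint A u₁ u₂) :=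
  whiskerRight_fst (prodTranslation A A (pairPoint A u₁ u₂)) (A.dualOf Θ hΘ).X

/-- **The image point `p(u) := (u₁ u₂⁻¹, φ_Θ(u₁ u₂))` of `A × Â`** by which `g′` moves under `t_u × 1` (print's
`(x₁ − x₂, L_{x₁ + x₂})`, `L_x = φ_Θ(x)`). [cite: Markman2025SecantWeil, §9.3 p. 71 L63–70] -/
def spanPoint : (A.prod (A.dualOf Θ hΘ)).Points ℂ :=
  lift (u₁ * u₂⁻¹) ((u₁ * u₂) ≫ phiThetaOver A hΘ)

/-- `p(u) ≫ pr_A = u₁ u₂⁻¹`. [cite: Markman2025SecantWeil, §9.3 p. 71 L63–70] -/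
@[simp]
theorem spanPoint_comp_fst : spanPoint A hΘ u₁ u₂ ≫ fst _ _ = u₁ * u₂⁻¹ := lift_fst _ _

/-- `p(u) ≫ pr_Â = φ_Θ(u₁ u₂)`. [cite: Markman2025SecantWeil, §9.3 p. 71 L63–70] -/
@[simp]
theorem spanPoint_comp_snd : spanPoint A hΘ u₁ u₂ ≫ snd _ _ = (u₁ * u₂) ≫ phiThetaOver A hΘ := lift_snd _ _

/-- `g′ ≫ pr_A = a · b⁻¹` (`a = pr₁₂ ≫ p₁`, `b = pr₁₂ ≫ p₂`). [cite: Markman2025SecantWeil, §9.3 p. 71 L54–70] -/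
theorem kernelSpanMap_comp_fst :
    kernelSpanMap A hΘ ≫ fst _ _ =
      (pr₁₂ A A (A.dualOf Θ hΘ) ≫ fst A.X A.X) * (pr₁₂ A A (A.dualOf Θ hΘ) ≫ snd A.X A.X)⁻¹ := by
  rw [kernelSpanMap, Category.assoc, lift_fst, ← Category.assoc, kernelShearIso_hom_comp_pr₁₂, Category.assoc,
    show (shearIso A).inv ≫ fst A.X A.X = fst A.X A.X * (snd A.X A.X)⁻¹ from lift_fst _ _, MonObj.comp_mul, GrpObj.comp_inv]

/-- `Ξ ≫ pr₃ = β · φ_Θ(a · b)` (the third coordinate of the kernel shear). [cite: Markman2025SecantWeil, §9.3 p. 71 L54–70] -/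
theorem kernelShearIso_hom_comp_snd :
    (kernelShearIso A hΘ).hom ≫ snd _ _ =
      snd _ _ * (((pr₁₂ A A (A.dualOf Θ hΘ) ≫ fst A.X A.X) * (pr₁₂ A A (A.dualOf Θ hΘ) ≫ snd A.X A.X)) ≫ phiThetaOver A hΘ) := by
  have h₁ : ((shearIso A).symm.hom ▷ (A.dualOf Θ hΘ).X) ≫ fst (A.X ⊗ A.X) (A.dualOf Θ hΘ).X =
      pr₁₂ A A (A.dualOf Θ hΘ) ≫ (shearIso A).inv := whiskerRight_fst _ _
  have h₂ : ((shearIso A).symm.hom ▷ (A.dualOf Θ hΘ).X) ≫ snd (A.X ⊗ A.X) (A.dualOf Θ hΘ).X = snd _ _ := whiskerRight_snd _ _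
  have hf : (shearIso A).inv ≫ fst A.X A.X = fst A.X A.X * (snd A.X A.X)⁻¹ := lift_fst _ _
  have e1 : (pr₁₂ A A (A.dualOf Θ hΘ) ≫ (shearIso A).inv) ≫ (fst A.X A.X * snd A.X A.X * snd A.X A.X) =
      (pr₁₂ A A (A.dualOf Θ hΘ) ≫ fst A.X A.X) * (pr₁₂ A A (A.dualOf Θ hΘ) ≫ snd A.X A.X) := by
    rw [MonObj.comp_mul, MonObj.comp_mul, Category.assoc, Category.assoc, hf, shearIso_inv_comp_snd, MonObj.comp_mul,
      GrpObj.comp_inv, inv_mul_cancel_right]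
  rw [kernelShearIso, Iso.trans_hom, Category.assoc, graphShearIso_hom_comp_snd, MonObj.comp_mul, whiskerRightIso_hom, h₂,
    ← Category.assoc ((shearIso A).symm.hom ▷ (A.dualOf Θ hΘ).X), h₁, ← Category.assoc, e1]

/-- `g′ ≫ pr_Â = β · φ_Θ(a · b)` (`β = pr₃`). [cite: Markman2025SecantWeil, §9.3 p. 71 L54–70] -/
theorem kernelSpanMap_comp_snd :
    kernelSpanMap A hΘ ≫ snd _ _ =
      snd _ _ * (((pr₁₂ A A (A.dualOf Θ hΘ) ≫ fst A.X A.X) * (pr₁₂ A A (A.dualOf Θ hΘ) ≫ snd A.X A.X)) ≫ phiThetaOver A hΘ) := by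
  rw [kernelSpanMap, Category.assoc, lift_snd, kernelShearIso_hom_comp_snd]

/-- `kernelSliceMap ≫ pr_A = b`. [cite: Markman2025SecantWeil, §9.3 p. 71 L54–70] -/
theorem kernelSliceMap_comp_fst :
    kernelSliceMap A hΘ ≫ fst _ _ = pr₁₂ A A (A.dualOf Θ hΘ) ≫ snd A.X A.X := by
  rw [kernelSliceMap, Category.assoc, lift_fst, ← Category.assoc, kernelShearIso_hom_comp_pr₁₂, Category.assoc,
    shearIso_inv_comp_snd]

/-- `kernelSliceMap ≫ pr_Â = β · φ_Θ(a · b)`. [cite: Markman2025SecantWeil, §9.3 p. 71 L54–70] -/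
theorem kernelSliceMap_comp_snd :
    kernelSliceMap A hΘ ≫ snd _ _ =
      snd _ _ * (((pr₁₂ A A (A.dualOf Θ hΘ) ≫ fst A.X A.X) * (pr₁₂ A A (A.dualOf Θ hΘ) ≫ snd A.X A.X)) ≫ phiThetaOver A hΘ) := by
  rw [kernelSliceMap, Category.assoc, lift_snd, kernelShearIso_hom_comp_snd]

/-- `(t_u × 1) ≫ a = u₁ · a`: first coordinate of `A × A` after translation (constant point `u₁ = toSpecOver _ ≫ u₁`).
[cite: GortzWedhorn2023, Def./Rem. 27.1 (p. 799)] -/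
theorem pairTranslation_comp_pr₁₂_fst :
    (prodTranslation A A (pairPoint A u₁ u₂) ▷ (A.dualOf Θ hΘ).X) ≫ pr₁₂ A A (A.dualOf Θ hΘ) ≫ fst A.X A.X =
      (toSpecOver _ ≫ u₁) * (pr₁₂ A A (A.dualOf Θ hΘ) ≫ fst A.X A.X) := by
  rw [← Category.assoc, pairTranslation_comp_pr₁₂, Category.assoc, prodTranslation_comp_fst, pairPoint_comp_fst,
    ← Category.assoc, AbelianVariety.comp_translation_eq_mul]

/-- Second coordinate after translation: `(t_u × 1) ≫ b = u₂ · b`. [cite: GortzWedhorn2023, Def./Rem. 27.1 (p. 799)] -/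
theorem pairTranslation_comp_pr₁₂_snd :
    (prodTranslation A A (pairPoint A u₁ u₂) ▷ (A.dualOf Θ hΘ).X) ≫ pr₁₂ A A (A.dualOf Θ hΘ) ≫ snd A.X A.X =
      (toSpecOver _ ≫ u₂) * (pr₁₂ A A (A.dualOf Θ hΘ) ≫ snd A.X A.X) := by
  rw [← Category.assoc, pairTranslation_comp_pr₁₂, Category.assoc, prodTranslation_comp_snd, pairPoint_comp_snd,
    ← Category.assoc, AbelianVariety.comp_translation_eq_mul]

/-- Third coordinate after translation: `(t_u × 1) ≫ β = β`. [cite: GortzWedhorn2023, Def./Rem. 27.1 (p. 799)] -/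
theorem pairTranslation_comp_snd :
    (prodTranslation A A (pairPoint A u₁ u₂) ▷ (A.dualOf Θ hΘ).X) ≫ snd _ _ = snd _ _ := whiskerRight_snd _ _

/-- **THE AUTOMORPHISM SQUARE `(t_u × 1_Â) ≫ g′ = g′ ≫ t_{p(u)}`** with `p(u) = (u₁u₂⁻¹, φ_Θ(u₁u₂))` — print's conjugation
«`μ⁻¹((τ_{x₁}, τ_{x₂})(μ(x, y))) = (x + x₁ − x₂, y + x₂)`», «`(τ_{x₁−x₂}, τ_{L_{x₁+x₂}})`» read on the span leg `g′`
(`A` is commutative). [cite: Markman2025SecantWeil, §9.3 p. 71 L54–70] -/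
theorem pairTranslation_comp_kernelSpanMap :
    (prodTranslation A A (pairPoint A u₁ u₂) ▷ (A.dualOf Θ hΘ).X) ≫ kernelSpanMap A hΘ =
      kernelSpanMap A hΘ ≫ prodTranslation A (A.dualOf Θ hΘ) (spanPoint A hΘ u₁ u₂) := by
  have L₁ : ((prodTranslation A A (pairPoint A u₁ u₂) ▷ (A.dualOf Θ hΘ).X) ≫ kernelSpanMap A hΘ) ≫ fst _ _ =
      ((toSpecOver _ ≫ u₁) * (pr₁₂ A A (A.dualOf Θ hΘ) ≫ fst A.X A.X)) *
        ((toSpecOver _ ≫ u₂) * (pr₁₂ A A (A.dualOf Θ hΘ) ≫ snd A.X A.X))⁻¹ := by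
    rw [Category.assoc, kernelSpanMap_comp_fst, MonObj.comp_mul, GrpObj.comp_inv, pairTranslation_comp_pr₁₂_fst,
      pairTranslation_comp_pr₁₂_snd]
  have R₁ : (kernelSpanMap A hΘ ≫ prodTranslation A (A.dualOf Θ hΘ) (spanPoint A hΘ u₁ u₂)) ≫ fst _ _ =
      ((toSpecOver _ ≫ u₁) * (toSpecOver _ ≫ u₂)⁻¹) *
        ((pr₁₂ A A (A.dualOf Θ hΘ) ≫ fst A.X A.X) * (pr₁₂ A A (A.dualOf Θ hΘ) ≫ snd A.X A.X)⁻¹) := by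
    rw [Category.assoc, prodTranslation_comp_fst, spanPoint_comp_fst, ← Category.assoc, AbelianVariety.comp_translation_eq_mul,
      kernelSpanMap_comp_fst, MonObj.comp_mul, GrpObj.comp_inv]
  have L₂ : ((prodTranslation A A (pairPoint A u₁ u₂) ▷ (A.dualOf Θ hΘ).X) ≫ kernelSpanMap A hΘ) ≫ snd _ _ =
      snd _ _ * ((((toSpecOver _ ≫ u₁) ≫ phiThetaOver A hΘ) * ((pr₁₂ A A (A.dualOf Θ hΘ) ≫ fst A.X A.X) ≫ phiThetaOver A hΘ)) *
        (((toSpecOver _ ≫ u₂) ≫ phiThetaOver A hΘ) * ((pr₁₂ A A (A.dualOf Θ hΘ) ≫ snd A.X A.X) ≫ phiThetaOver A hΘ))) := by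
    rw [Category.assoc, kernelSpanMap_comp_snd, MonObj.comp_mul, pairTranslation_comp_snd, ← Category.assoc, MonObj.comp_mul,
      pairTranslation_comp_pr₁₂_fst, pairTranslation_comp_pr₁₂_snd, MonObj.mul_comp, MonObj.mul_comp, MonObj.mul_comp]
  have R₂ : (kernelSpanMap A hΘ ≫ prodTranslation A (A.dualOf Θ hΘ) (spanPoint A hΘ u₁ u₂)) ≫ snd _ _ =
      (((toSpecOver _ ≫ u₁) ≫ phiThetaOver A hΘ) * ((toSpecOver _ ≫ u₂) ≫ phiThetaOver A hΘ)) *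
        (snd _ _ * (((pr₁₂ A A (A.dualOf Θ hΘ) ≫ fst A.X A.X) ≫ phiThetaOver A hΘ) *
          ((pr₁₂ A A (A.dualOf Θ hΘ) ≫ snd A.X A.X) ≫ phiThetaOver A hΘ))) := by
    rw [Category.assoc, prodTranslation_comp_snd, spanPoint_comp_snd, ← Category.assoc, AbelianVariety.comp_translation_eq_mul,
      kernelSpanMap_comp_snd, ← Category.assoc (toSpecOver _) (u₁ * u₂) (phiThetaOver A hΘ), MonObj.comp_mul (toSpecOver _),
      MonObj.mul_comp, MonObj.mul_comp]
  apply CartesianMonoidalCategory.hom_ext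
  · rw [L₁, R₁, mul_inv_rev]
    ac_rfl
  · rw [L₂, R₂]
    ac_rfl

/-- The same square on underlying schemes (the `w` of `derivedPushforwardPlusBaseChangeIsoOfIso g′ g′ (t_u × 1) t_{p(u)}`).
[cite: Markman2025SecantWeil, §9.3 p. 71 L54–70] -/
theorem kernelSpanMap_left_comp_prodTranslationSchemeIso :
    (kernelSpanMap A hΘ).left ≫ (prodTranslationSchemeIso A (A.dualOf Θ hΘ) (spanPoint A hΘ u₁ u₂)).hom =
      (pairTranslationIso A hΘ u₁ u₂).hom ≫ (kernelSpanMap A hΘ).left := by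
  change (kernelSpanMap A hΘ).left ≫ (prodTranslation A (A.dualOf Θ hΘ) (spanPoint A hΘ u₁ u₂)).left =
    (prodTranslation A A (pairPoint A u₁ u₂) ▷ (A.dualOf Θ hΘ).X).left ≫ (kernelSpanMap A hΘ).left
  rw [← Over.comp_left, ← Over.comp_left, pairTranslation_comp_kernelSpanMap]

/-- `(t_u × 1) ≫ pr₁₂ = pr₁₂ ≫ t_u` on underlying schemes. [cite: GortzWedhorn2023, Def./Rem. 27.1 (p. 799)] -/
theorem pairTranslationIso_hom_comp_pr₁₂_left :
    (pairTranslationIso A hΘ u₁ u₂).hom ≫ (pr₁₂ A A (A.dualOf Θ hΘ)).left =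
      (pr₁₂ A A (A.dualOf Θ hΘ)).left ≫ (prodTranslationSchemeIso A A (pairPoint A u₁ u₂)).hom := by
  change (prodTranslation A A (pairPoint A u₁ u₂) ▷ (A.dualOf Θ hΘ).X).left ≫ (pr₁₂ A A (A.dualOf Θ hΘ)).left =
    (pr₁₂ A A (A.dualOf Θ hΘ)).left ≫ (prodTranslation A A (pairPoint A u₁ u₂)).left
  rw [← Over.comp_left, ← Over.comp_left, pairTranslation_comp_pr₁₂]

end Squares

/-! ### §2 Class calculus on `Z`-valued points -/

section ClassCalculus

variable (hK : A.KTheta Θ = ⊥) {T : SchemeOver ℂ} [IsIntegral T.left]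

omit [IsIntegral T.left] in
/-- `(f ≫ g)^* = f^* ∘ g^*` on `Ȟ¹(–, 𝒪^×)` (the tree's `CechPic.pullback_comp` of `Modules/UnitCocyclePresented`, re-proved
here to keep the import closure small). [cite: Hartshorne1977, II Ex. 6.8 (functoriality of f^* on Pic)] -/
private theorem CechPic.pullback_comp'' {X Y Z : Scheme.{0}} (f : X ⟶ Y) (g : Y ⟶ Z) (c : CechPic Z) :
    CechPic.pullback (f ≫ g) c = CechPic.pullback f (CechPic.pullback g c) := by
  obtain ⟨c, rfl⟩ := CechPic.mk_surjective c
  rw [CechPic.pullback_mk, CechPic.pullback_mk, CechPic.pullback_mk]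
  refine CechPic.sound (UnitCocycle.equiv_of_eq _ _
    (fun x => f ⁻¹ᵁ (g ⁻¹ᵁ c.U (g.base (f.base x)))) (fun x => c.mem (g.base (f.base x)))
    (fun x => le_of_eq rfl) (fun x => le_rfl) fun x y V hx hy => ?_)
  change (g.appLE _ _ _ ≫ f.appLE _ V _) (c.g _ _ _ _ _) = (f ≫ g).appLE _ V _ (c.g _ _ _ _ _)
  rw [Scheme.Hom.appLE_comp_appLE]
  rfl

omit [IsIntegral T.left] in
/-- `g ≫ toSpecOver S = toSpecOver T` (maps to `Spec ℂ` over `Spec ℂ` are unique). [cite: GortzWedhorn2023, Def./Rem. 27.1 (p. 799)] -/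
private theorem comp_toSpecOver' {S : SchemeOver ℂ} (g : T ⟶ S) : g ≫ toSpecOver S = toSpecOver T := by
  ext1
  rw [Over.comp_left, toSpecOver_left, toSpecOver_left, Over.w]

/-- **The class of `P_α` along a `T`-valued point `x : T → A` is `Λ(x, φ_Θ⁻¹(α)_T)`** (`[P_α] = (𝟙, α)^*[𝒫]` and the class
of `𝒫` along `(x, α_T)` is Mumford's pairing). [cite: Lange2023AbelianVarietiesComplex, §1.4.2 and Lemma 6.1.3] -/
theorem ofMul_pullback_detClass_linePt (x : T ⟶ A.X) (α : (A.dualOf Θ hΘ).Points ℂ) :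
    Additive.ofMul (CechPic.pullback x.left (detClass (isFiniteLocallyFree_linePt A hΘ hK α))) =
      AbelianVariety.Lam Θ (cechCl T.left) x (toSpecOver T ≫ α ≫ phiThetaInv A hΘ hK) := by
  rw [detClass_linePt_eq_pullback, ← CechPic.pullback_comp'', ← Over.comp_left, pullback_detClass_poincareSheaf,
    Category.assoc, lift_fst, Category.comp_id, Category.assoc, lift_snd_assoc, Category.assoc (toSpecOver A.X) α,
    ← Category.assoc x (toSpecOver A.X), comp_toSpecOver']

/-- **The class of `P̂_{x₀}` along a `T`-valued point `y : T → Â` is `Λ((x₀)_T, φ_Θ⁻¹ ∘ y)`.**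
[cite: Lange2023AbelianVarietiesComplex, §6.1.1 and Lemma 6.1.3] -/
theorem ofMul_pullback_detClass_linePtHat (y : T ⟶ (A.dualOf Θ hΘ).X) (x₀ : A.Points ℂ) :
    Additive.ofMul (CechPic.pullback y.left (detClass (isFiniteLocallyFree_linePtHat A hΘ hK x₀))) =
      AbelianVariety.Lam Θ (cechCl T.left) (toSpecOver T ≫ x₀) (y ≫ phiThetaInv A hΘ hK) := by
  rw [detClass_linePtHat_eq_pullback, ← CechPic.pullback_comp'', ← Over.comp_left, pullback_detClass_poincareSheaf,
    Category.assoc, lift_fst, ← Category.assoc, comp_toSpecOver', Category.assoc, lift_snd_assoc, Category.id_comp]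

/-- `Λ(c_T, d_T) = 0` for constant points (all three `λ`'s vanish, `lam_toSpecOver_comp`). [cite: MumfordAV1970, §8 (the pairing Λ(L))] -/
theorem Lam_const_const (c d : A.Points ℂ) :
    AbelianVariety.Lam Θ (cechCl T.left) (toSpecOver T ≫ c) (toSpecOver T ≫ d) = 0 := by
  unfold AbelianVariety.Lam
  rw [← MonObj.comp_mul, AbelianVariety.lam_toSpecOver_comp (linEquiv_iff_cechCl_eq T.left) (cechCl_add T.left),
    AbelianVariety.lam_toSpecOver_comp (linEquiv_iff_cechCl_eq T.left) (cechCl_add T.left),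
    AbelianVariety.lam_toSpecOver_comp (linEquiv_iff_cechCl_eq T.left) (cechCl_add T.left), sub_zero, sub_zero]

/-- `Λ(x, y⁻¹) = −Λ(x, y)` (biadditivity). [cite: MumfordAV1970, §6 Cor. 4 (p. 59) and §8] -/
theorem Lam_inv_right (x y : T ⟶ A.X) :
    AbelianVariety.Lam Θ (cechCl T.left) x y⁻¹ = -AbelianVariety.Lam Θ (cechCl T.left) x y := by
  have h := AbelianVariety.Lam_mul_right (L := Θ) (cechCl_add T.left) (linEquiv_iff_cechCl_eq T.left)
    A.cubicalStructure_linEquiv_holds x y y⁻¹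
  rw [mul_inv_cancel, AbelianVariety.Lam_comm, AbelianVariety.Lam_one_left (linEquiv_iff_cechCl_eq T.left) (cechCl_add T.left)] at h
  exact (neg_eq_of_add_eq_zero_right h.symm).symm

/-- `λ(x y) = Λ(x, y) + λ(x) + λ(y)` (the definition of `Λ`, rearranged). [cite: MumfordAV1970, §8 (the pairing Λ(L))] -/
theorem lam_mul_eq (x y : T ⟶ A.X) :
    AbelianVariety.lam Θ (cechCl T.left) (x * y) =
      AbelianVariety.Lam Θ (cechCl T.left) x y + AbelianVariety.lam Θ (cechCl T.left) x + AbelianVariety.lam Θ (cechCl T.left) y := by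
  unfold AbelianVariety.Lam; abel

/-- **The class of `𝒪(Θ)` along `x : T → A`**: `ofMul(x^*[Θ]) = λ(x)`. [cite: GortzWedhorn2020, Prop. 11.21 (p. 374)] -/
theorem ofMul_pullback_cechClass (x : T ⟶ A.X) :
    Additive.ofMul (CechPic.pullback x.left Θ.cechClass) = AbelianVariety.lam Θ (cechCl T.left) x := by
  rw [← toMul_lam, ofMul_toMul]

/-- **The class of the span kernel along a `T`-valued point `g` of `Z = (A×A)×Â`**:
`ofMul (g^*[𝒩₁]) = −Λ(g·b, (g·β·φ_Θ⁻¹) · (g·a) · (g·b))` (`𝒩₁ = (b, β·φ_Θ(ab))^*𝒫^∨`). [cite: Markman2025SecantWeil, §9.3 p. 71 L54–70]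
[cite: Lange2023AbelianVarietiesComplex, Lemma 6.1.3] -/
theorem ofMul_pullback_detClass_markmanSpanKernel (g : T ⟶ (A.X ⊗ A.X) ⊗ (A.dualOf Θ hΘ).X) :
    Additive.ofMul (CechPic.pullback g.left (detClass (isFiniteLocallyFree_markmanSpanKernel A hΘ hK))) =
      -AbelianVariety.Lam Θ (cechCl T.left) (g ≫ pr₁₂ A A (A.dualOf Θ hΘ) ≫ snd A.X A.X)
        ((g ≫ snd _ _ ≫ phiThetaInv A hΘ hK) *
          ((g ≫ pr₁₂ A A (A.dualOf Θ hΘ) ≫ fst A.X A.X) * (g ≫ pr₁₂ A A (A.dualOf Θ hΘ) ≫ snd A.X A.X))) := by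
  have hD := isFiniteLocallyFree_dual (isFiniteLocallyFree_poincareSheaf A hΘ hK)
  rw [detClass_eq_of_iso (markmanSpanKernelIsoPullbackSlice A hΘ hK) _ (hD.pullback _), detClass_pullback _ hD,
    detClass_dual (isFiniteLocallyFree_poincareSheaf A hΘ hK), map_inv, map_inv, ← CechPic.pullback_comp'', ← Over.comp_left, ofMul_inv, pullback_detClass_poincareSheaf, Category.assoc,
    kernelSliceMap_comp_fst, Category.assoc, ← Category.assoc (kernelSliceMap A hΘ), kernelSliceMap_comp_snd, MonObj.mul_comp,
    MonObj.comp_mul, Category.assoc, phiTheta_comp_phiThetaInv, Category.comp_id, MonObj.comp_mul]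

end ClassCalculus

/-! ### §3 The twisted span kernel, `M_u`, and `[(t_u × 1)^*𝒩] = [𝒩] · g′^*[M_u]` -/

section Twisted

variable (hK : A.KTheta Θ = ⊥)

/-- **The twisted span kernel `𝒩 := 𝒩₁ ⊗ pr₁₂^*(𝒪(Θ) ⊠ 𝒪(Θ)) = 𝒩₁ ⊗ a^*𝒪(Θ) ⊗ b^*𝒪(Θ)`** on `(A × A) × Â` — print's
source twist `[Θ ⊠ Θ] ⊗` (§9.2) absorbed into the kernel of the span transform. [cite: Markman2025SecantWeil, §9.2 and §9.3 p. 70 L47]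
[cite: Mukai1981, §1 (1.1)] -/
def markmanTwistedKernel : ((A.X ⊗ A.X) ⊗ (A.dualOf Θ hΘ).X).left.Modules :=
  tensorObj (tensorObj (markmanSpanKernel A hΘ hK)
    ((Scheme.Modules.pullback (pr₁₂ A A (A.dualOf Θ hΘ) ≫ fst A.X A.X).left).obj (lineBundle Θ.toUnitCocycle)))
    ((Scheme.Modules.pullback (pr₁₂ A A (A.dualOf Θ hΘ) ≫ snd A.X A.X).left).obj (lineBundle Θ.toUnitCocycle))

/-- `𝒩` is finite locally free. [cite: Mukai1981, §1 (1.1)] -/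
theorem isFiniteLocallyFree_markmanTwistedKernel : IsFiniteLocallyFree (markmanTwistedKernel A hΘ hK) :=
  isFiniteLocallyFree_tensorObj _ _
    (isFiniteLocallyFree_tensorObj _ _ (isFiniteLocallyFree_markmanSpanKernel A hΘ hK)
      (Θ.toUnitCocycle.isFiniteLocallyFree_lineBundle.pullback _))
    (Θ.toUnitCocycle.isFiniteLocallyFree_lineBundle.pullback _)

/-- `𝒩` has rank one. [cite: Mukai1981, §1 (1.1)] -/
theorem hasRank_markmanTwistedKernel : HasRank (markmanTwistedKernel A hΘ hK) 1 :=
  hasRank_tensorObj_one (hasRank_tensorObj_one (hasRank_markmanSpanKernel A hΘ hK)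
    (hasRank_pullback _ Θ.toUnitCocycle.hasRank_lineBundle)) (hasRank_pullback _ Θ.toUnitCocycle.hasRank_lineBundle)

/-- **`[𝒩] = [𝒩₁] · a^*[Θ] · b^*[Θ]`** in `Ȟ¹(Z, 𝒪^×)`. [cite: Markman2025SecantWeil, §9.3 p. 71 L54–70] -/
theorem detClass_markmanTwistedKernel :
    detClass (isFiniteLocallyFree_markmanTwistedKernel A hΘ hK) =
      detClass (isFiniteLocallyFree_markmanSpanKernel A hΘ hK) *
        CechPic.pullback (pr₁₂ A A (A.dualOf Θ hΘ) ≫ fst A.X A.X).left Θ.cechClass *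
        CechPic.pullback (pr₁₂ A A (A.dualOf Θ hΘ) ≫ snd A.X A.X).left Θ.cechClass := by
  have hΘ₁ := Θ.toUnitCocycle.isFiniteLocallyFree_lineBundle
  have hΘr := Θ.toUnitCocycle.hasRank_lineBundle
  have hN := isFiniteLocallyFree_markmanSpanKernel A hΘ hK
  have step1 := detClass_tensorObj_of_hasRank_one
      (hasRank_tensorObj_one (hasRank_markmanSpanKernel A hΘ hK)
        (hasRank_pullback (pr₁₂ A A (A.dualOf Θ hΘ) ≫ fst A.X A.X).left hΘr))
      (hasRank_pullback (pr₁₂ A A (A.dualOf Θ hΘ) ≫ snd A.X A.X).left hΘr)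
      (isFiniteLocallyFree_tensorObj _ _ hN (hΘ₁.pullback (pr₁₂ A A (A.dualOf Θ hΘ) ≫ fst A.X A.X).left))
      (hΘ₁.pullback (pr₁₂ A A (A.dualOf Θ hΘ) ≫ snd A.X A.X).left) (isFiniteLocallyFree_markmanTwistedKernel A hΘ hK)
  have step2 := detClass_tensorObj_of_hasRank_one (hasRank_markmanSpanKernel A hΘ hK)
      (hasRank_pullback (pr₁₂ A A (A.dualOf Θ hΘ) ≫ fst A.X A.X).left hΘr) hN
      (hΘ₁.pullback (pr₁₂ A A (A.dualOf Θ hΘ) ≫ fst A.X A.X).left)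
  have step3 := detClass_pullback (pr₁₂ A A (A.dualOf Θ hΘ) ≫ fst A.X A.X).left hΘ₁
  have step4 := detClass_pullback (pr₁₂ A A (A.dualOf Θ hΘ) ≫ snd A.X A.X).left hΘ₁
  rw [step1, step2, step3, step4, detClass_lineBundle_toUnitCocycle]

/-- **The class of the twisted kernel along a `T`-valued point `g`:**
`ofMul (g^*[𝒩]) = −Λ(g·b, (g·β·φ⁻¹)·(g·a)·(g·b)) + λ(g·a) + λ(g·b)`. [cite: Markman2025SecantWeil, §9.3 p. 71 L54–70] -/
theorem ofMul_pullback_detClass_markmanTwistedKernel {T : SchemeOver ℂ} [IsIntegral T.left]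
    (g : T ⟶ (A.X ⊗ A.X) ⊗ (A.dualOf Θ hΘ).X) :
    Additive.ofMul (CechPic.pullback g.left (detClass (isFiniteLocallyFree_markmanTwistedKernel A hΘ hK))) =
      -AbelianVariety.Lam Θ (cechCl T.left) (g ≫ pr₁₂ A A (A.dualOf Θ hΘ) ≫ snd A.X A.X)
          ((g ≫ snd _ _ ≫ phiThetaInv A hΘ hK) *
            ((g ≫ pr₁₂ A A (A.dualOf Θ hΘ) ≫ fst A.X A.X) * (g ≫ pr₁₂ A A (A.dualOf Θ hΘ) ≫ snd A.X A.X))) +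
        AbelianVariety.lam Θ (cechCl T.left) (g ≫ pr₁₂ A A (A.dualOf Θ hΘ) ≫ fst A.X A.X) +
        AbelianVariety.lam Θ (cechCl T.left) (g ≫ pr₁₂ A A (A.dualOf Θ hΘ) ≫ snd A.X A.X) := by
  rw [detClass_markmanTwistedKernel, MonoidHom.map_mul, MonoidHom.map_mul, ofMul_mul, ofMul_mul,
    ofMul_pullback_detClass_markmanSpanKernel,
    ← CechPic.pullback_comp'', ← CechPic.pullback_comp'', ← Over.comp_left, ← Over.comp_left, ofMul_pullback_cechClass,
    ofMul_pullback_cechClass]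

variable (u₁ u₂ : A.Points ℂ)

/-- **`M_u := pr_A^*P_{φ_Θ(u₁)} ⊗ (pr_Â^*P̂_{u₂})^∨`** on `A × Â` — print's `L_g = π₁^*L_{x₁} ⊗ π₂^*𝒫_{−x₂}` for
`g = (x₁, x₂)`: the Pic⁰ twist by which Markman's `Φ̃` moves the translation `t_{(u₁,u₂)}`. [cite: Markman2025SecantWeil, §9.3 p. 71 L63–70] -/
def translateTwist : (A.X ⊗ (A.dualOf Θ hΘ).X).left.Modules :=
  tensorObj ((Scheme.Modules.pullback (fst A.X (A.dualOf Θ hΘ).X).left).obj (linePt A hΘ hK (u₁ ≫ phiThetaOver A hΘ)))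
    (Modules.dual ((Scheme.Modules.pullback (snd A.X (A.dualOf Θ hΘ).X).left).obj (linePtHat A hΘ hK u₂)))

/-- `M_u` is finite locally free. [cite: Markman2025SecantWeil, §9.3 p. 71 L63–70] -/
theorem isFiniteLocallyFree_translateTwist : IsFiniteLocallyFree (translateTwist A hΘ hK u₁ u₂) :=
  isFiniteLocallyFree_tensorObj _ _ ((isFiniteLocallyFree_linePt A hΘ hK _).pullback _)
    (isFiniteLocallyFree_dual ((isFiniteLocallyFree_linePtHat A hΘ hK _).pullback _))

/-- `M_u` has rank one. [cite: Markman2025SecantWeil, §9.3 p. 71 L63–70] -/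
theorem hasRank_translateTwist : HasRank (translateTwist A hΘ hK u₁ u₂) 1 :=
  hasRank_tensorObj_one (hasRank_pullback _ (hasRank_linePt A hΘ hK _))
    (hasRank_dual (hasRank_pullback _ (hasRank_linePtHat A hΘ hK _)))

/-- **The class of `M_u` along a `T`-valued point `h` of `A × Â`:** `ofMul (h^*[M_u]) = Λ(h·p_A, (u₁)_T) − Λ((u₂)_T, h·p_Â·φ⁻¹)`.
[cite: Markman2025SecantWeil, §9.3 p. 71 L63–70] [cite: Lange2023AbelianVarietiesComplex, Lemma 6.1.3] -/
theorem ofMul_pullback_detClass_translateTwist {T : SchemeOver ℂ} [IsIntegral T.left] (h : T ⟶ A.X ⊗ (A.dualOf Θ hΘ).X) :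
    Additive.ofMul (CechPic.pullback h.left (detClass (isFiniteLocallyFree_translateTwist A hΘ hK u₁ u₂))) =
      AbelianVariety.Lam Θ (cechCl T.left) (h ≫ fst _ _) (toSpecOver T ≫ u₁) -
        AbelianVariety.Lam Θ (cechCl T.left) (toSpecOver T ≫ u₂) (h ≫ snd _ _ ≫ phiThetaInv A hΘ hK) := by
  have h₁ := isFiniteLocallyFree_linePt A hΘ hK (u₁ ≫ phiThetaOver A hΘ)
  have h₂ := isFiniteLocallyFree_linePtHat A hΘ hK u₂
  rw [detClass_tensorObj_of_hasRank_one (hasRank_pullback _ (hasRank_linePt A hΘ hK _))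
      (hasRank_dual (hasRank_pullback _ (hasRank_linePtHat A hΘ hK _))) (h₁.pullback _) (isFiniteLocallyFree_dual (h₂.pullback _))
      (isFiniteLocallyFree_translateTwist A hΘ hK u₁ u₂),
    detClass_dual (h₂.pullback _), detClass_pullback _ h₁, detClass_pullback _ h₂, MonoidHom.map_mul, MonoidHom.map_inv, ofMul_mul,
    ofMul_inv,
    ← CechPic.pullback_comp'', ← CechPic.pullback_comp'', ← Over.comp_left, ← Over.comp_left, ofMul_pullback_detClass_linePt,
    ofMul_pullback_detClass_linePtHat, Category.assoc u₁, phiTheta_comp_phiThetaInv, Category.comp_id, sub_eq_add_neg,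
    Category.assoc]

end Twisted


/-! ### §4 The translate identity `[(t_u × 1)^*𝒩] = [𝒩] · g′^*[M_u]` and its module form -/

section TranslateIdentity

variable (hK : A.KTheta Θ = ⊥) (u₁ u₂ : A.Points ℂ)

/-- `(A × A) × Â` is an integral scheme (it is the abelian variety `(A × A) × Â`). [cite: MumfordAV1970, §4 (abelian varieties are irreducible)] -/
theorem isIntegral_pairDual : IsIntegral ((A.X ⊗ A.X) ⊗ (A.dualOf Θ hΘ).X).left :=
  GeometricallyIntegral.isIntegral_of_subsingleton ((A.prod A).prod (A.dualOf Θ hΘ)).X.hom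

/-- **THE TRANSLATE IDENTITY IN `Ȟ¹`: `(t_u × 1_Â)^*[𝒩] = [𝒩] · g′^*[M_u]`** for the twisted span kernel `𝒩` and every
complex point `u = (u₁, u₂)` of `A × A` — Markman's Lemma 9.3.3 «`Φ̃ ∘ (τ_{x₁}, τ_{x₂})_* ∘ Φ̃⁻¹ ≅ ((π₁^*L_{x₁} ⊗ π₂^*𝒫_{−x₂}) ⊗) ∘
(τ_{x₁−x₂}, τ_{L_{x₁+x₂}})_*`» read on the kernel: biadditivity of Mumford's `Λ` (the cubical structure) and nothing else.
[cite: Markman2025SecantWeil, §9.3 Lemma 9.3.3 p. 71 L54–70] [cite: MumfordAV1970, §6 Cor. 4 and §8] -/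
theorem pullback_pairTranslation_detClass_markmanTwistedKernel :
    CechPic.pullback (pairTranslationIso A hΘ u₁ u₂).hom (detClass (isFiniteLocallyFree_markmanTwistedKernel A hΘ hK)) =
      detClass (isFiniteLocallyFree_markmanTwistedKernel A hΘ hK) *
        CechPic.pullback (kernelSpanMap A hΘ).left (detClass (isFiniteLocallyFree_translateTwist A hΘ hK u₁ u₂)) := by
  haveI := isIntegral_pairDual A hΘ
  have hadd := cechCl_add ((A.X ⊗ A.X) ⊗ (A.dualOf Θ hΘ).X).left
  have heq := linEquiv_iff_cechCl_eq ((A.X ⊗ A.X) ⊗ (A.dualOf Θ hΘ).X).left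
  have hcube := A.cubicalStructure_linEquiv_holds
  have hml : ∀ x y z : (A.X ⊗ A.X) ⊗ (A.dualOf Θ hΘ).X ⟶ A.X,
      AbelianVariety.Lam Θ (cechCl ((A.X ⊗ A.X) ⊗ (A.dualOf Θ hΘ).X).left) (x * y) z =
        AbelianVariety.Lam Θ (cechCl ((A.X ⊗ A.X) ⊗ (A.dualOf Θ hΘ).X).left) x z +
          AbelianVariety.Lam Θ (cechCl ((A.X ⊗ A.X) ⊗ (A.dualOf Θ hΘ).X).left) y z :=
    fun x y z => AbelianVariety.Lam_mul_left hadd heq hcube x y z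
  have hmr : ∀ x y z : (A.X ⊗ A.X) ⊗ (A.dualOf Θ hΘ).X ⟶ A.X,
      AbelianVariety.Lam Θ (cechCl ((A.X ⊗ A.X) ⊗ (A.dualOf Θ hΘ).X).left) x (y * z) =
        AbelianVariety.Lam Θ (cechCl ((A.X ⊗ A.X) ⊗ (A.dualOf Θ hΘ).X).left) x y +
          AbelianVariety.Lam Θ (cechCl ((A.X ⊗ A.X) ⊗ (A.dualOf Θ hΘ).X).left) x z :=
    fun x y z => AbelianVariety.Lam_mul_right hadd heq hcube x y z
  have hlc : ∀ P : A.Points ℂ,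
      AbelianVariety.lam Θ (cechCl ((A.X ⊗ A.X) ⊗ (A.dualOf Θ hΘ).X).left) (toSpecOver ((A.X ⊗ A.X) ⊗ (A.dualOf Θ hΘ).X) ≫ P) = 0 :=
    fun P => AbelianVariety.lam_toSpecOver_comp heq hadd P
  have hcc := Lam_const_const A (Θ := Θ) (T := (A.X ⊗ A.X) ⊗ (A.dualOf Θ hΘ).X)
  have hinv := Lam_inv_right A (Θ := Θ) (T := (A.X ⊗ A.X) ⊗ (A.dualOf Θ hΘ).X)
  have hle := lam_mul_eq A (Θ := Θ) (T := (A.X ⊗ A.X) ⊗ (A.dualOf Θ hΘ).X)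
  -- the identity at `g = 𝟙`: the class of `𝒩` itself
  have h0 := ofMul_pullback_detClass_markmanTwistedKernel A hΘ hK (𝟙 ((A.X ⊗ A.X) ⊗ (A.dualOf Θ hΘ).X))
  rw [Over.id_left, CechPic.pullback_id_apply] at h0
  simp only [Category.id_comp] at h0
  -- pass to the additive group and expand everything by biadditivity
  apply Additive.ofMul.injective
  rw [ofMul_mul, h0, pairTranslationIso_hom, ofMul_pullback_detClass_markmanTwistedKernel, pairTranslation_comp_pr₁₂_fst,
    pairTranslation_comp_pr₁₂_snd, ← Category.assoc (prodTranslation A A (pairPoint A u₁ u₂) ▷ (A.dualOf Θ hΘ).X),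
    pairTranslation_comp_snd, ofMul_pullback_detClass_translateTwist, kernelSpanMap_comp_fst,
    ← Category.assoc (kernelSpanMap A hΘ), kernelSpanMap_comp_snd, MonObj.mul_comp, Category.assoc, phiTheta_comp_phiThetaInv,
    Category.comp_id]
  simp only [hml, hmr, hle, hlc, hcc, add_zero, zero_add]
  rw [AbelianVariety.Lam_comm (pr₁₂ A A (A.dualOf Θ hΘ) ≫ snd A.X A.X) (toSpecOver _ ≫ u₁),
    AbelianVariety.Lam_comm (pr₁₂ A A (A.dualOf Θ hΘ) ≫ snd A.X A.X) (toSpecOver _ ≫ u₂),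
    AbelianVariety.Lam_comm (pr₁₂ A A (A.dualOf Θ hΘ) ≫ fst A.X A.X) (toSpecOver _ ≫ u₁),
    AbelianVariety.Lam_comm ((pr₁₂ A A (A.dualOf Θ hΘ) ≫ snd A.X A.X)⁻¹) (toSpecOver _ ≫ u₁), hinv]
  abel

/-- **MODULE FORM: `(t_u × 1_Â)^*𝒩 ≅ 𝒩 ⊗ g′^*M_u`** for the twisted span kernel of Markman's `Φ̃` and every complex point
`u = (u₁, u₂)` of `A × A` (rank-one modules are classified by their class). Objectwise; no linearisation is chosen.
[cite: Markman2025SecantWeil, §9.3 Lemma 9.3.3 p. 71 L54–70] [cite: Lange2023AbelianVarietiesComplex, Lemma 6.1.3] -/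
theorem nonempty_pullback_pairTranslation_markmanTwistedKernel_iso :
    Nonempty ((Scheme.Modules.pullback (pairTranslationIso A hΘ u₁ u₂).hom).obj (markmanTwistedKernel A hΘ hK) ≅
      tensorObj (markmanTwistedKernel A hΘ hK)
        ((Scheme.Modules.pullback (kernelSpanMap A hΘ).left).obj (translateTwist A hΘ hK u₁ u₂))) := by
  have hN := isFiniteLocallyFree_markmanTwistedKernel A hΘ hK
  have hN₁ := hasRank_markmanTwistedKernel A hΘ hK
  have hM := isFiniteLocallyFree_translateTwist A hΘ hK u₁ u₂
  have hM₁ := hasRank_translateTwist A hΘ hK u₁ u₂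
  refine (nonempty_iso_iff_detClass_eq (hasRank_pullback (pairTranslationIso A hΘ u₁ u₂).hom hN₁)
    (hasRank_tensorObj_one hN₁ (hasRank_pullback (kernelSpanMap A hΘ).left hM₁))
    (hN.pullback (pairTranslationIso A hΘ u₁ u₂).hom)
    (isFiniteLocallyFree_tensorObj _ _ hN (hM.pullback (kernelSpanMap A hΘ).left))).2 ?_
  have e₁ := detClass_pullback (pairTranslationIso A hΘ u₁ u₂).hom hN
  have e₂ := detClass_tensorObj_of_hasRank_one hN₁ (hasRank_pullback (kernelSpanMap A hΘ).left hM₁) hN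
    (hM.pullback (kernelSpanMap A hΘ).left)
  have e₃ := detClass_pullback (kernelSpanMap A hΘ).left hM
  rw [e₁, pullback_pairTranslation_detClass_markmanTwistedKernel, e₂, e₃]

end TranslateIdentity


end Literature.AlgebraicGeometry.AbelianVarieties

end
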